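import Summits.RiemannHypothesis.RiemannHypothesis.Theses.XWucRLadder
import Summits.RiemannHypothesis.RiemannHypothesis.Theorems.Splittings.SplitXWucK1RN
import HarnessLib

/-!
# Route XWucRLadder (L9) — crux r2 `KCertNodeReal` = T52 «K1′(ℝ) AT THE STAKE» (stmt-RiemannHypothesis-23474) CLOSED BY NAME

The item is the REAL-VALUED class of the cell node K-CERT′ at the stake `θ = 21/500 = 0.042`, i.e. verbatim the
unfolding of `XWucG8.KCertLROn XWucG8.RealVal 400 (3/2) (21/500)` with the tree's `KCertRefutation.tfT` / `.Phi`
(byte-identical bodies to the chain's `XWucG8.tfT` / `.Phi`, so the match is definitional). The proof is the kernel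
theorem `Summit.RiemannHypothesis.RiemannHypothesis.Theorems.Splittings.XWucG8.kCertLROn_realVal_stake` of the x-wuc
GEN-11 chain (`SplitXWucK1R{A…N}.lean`, mechanical carve of the referee-passed extract 70c8eb2af2868881; ref g10 PASS
2026-08-27T22:59:46Z; RULINGs #330/#356), applied pointwise. RH-free, standard axioms. HONEST LABEL: splitting search
over kernel-typed RH-equivalences; K-CERT′ for complex `f` (item 23475 `KCertComplexStep`) stays OPEN; the route's RH
content sits in its other cruxes; nothing here bears on the truth of RH.
-/

-- D-0017: `Summit.RiemannHypothesis.RiemannHypothesis.…` duplicates the namespace BY DESIGN (single-problem summit).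
set_option linter.dupNamespace false

namespace Summit.RiemannHypothesis.RiemannHypothesis.Theorems.Splittings.XWucK1R

/-- **`KCertNodeReal` (item stmt-RiemannHypothesis-23474) holds** — K1′(ℝ) at the stake: for every `ε > 0`,
`κ₀ ∈ (0, ½)`, density `D ≥ 1` and continuous `f` real-valued on `[−1, 1]`, the localised two-lobe certificate with
ridge kept, window length `≤ 400`, dent `3/2`, credit `θ = 21/500`; by `XWucG8.kCertLROn_realVal_stake`. RH-free. -/
theorem kCertNodeReal_proof :
    Summit.RiemannHypothesis.RiemannHypothesis.Theses.XWucRLadder.KCertNodeReal := by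
  intro ε hε κ₀ hκ₀ hκ₀' D hD f hf hcont
  exact XWucG8.kCertLROn_realVal_stake ε hε κ₀ hκ₀ hκ₀' D hD f hf hcont

end Summit.RiemannHypothesis.RiemannHypothesis.Theorems.Splittings.XWucK1R
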